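import Summits.Ventures.CertifiedQuantumChemistry.Rows.LinearCombination
import Summits.Ventures.CertifiedQuantumChemistry.Rows.DifferencePencilAlignedRows
import HarnessLib

/-!
# Ventures/CertifiedQuantumChemistry — Rows/LinearCombinationAligned.lean: combination files built from
# ORBITAL-ALIGNED parents — the relabelled model `F.relabel π`, the `lincomb` pin carrying the two printed
# orbital maps, the identification `K = α·P_A(F) + β·P_B(G)`, and its transport to the difference rows of
# the PINNED pair `(F, G)`

HONEST FRAMING (verbatim): certified bounds for a stated model Hamiltonian in a stated basis; not a
claim about the real molecule or material beyond that model.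

Typer chem-type-01 (LADDER-CHEM cell chem-oracle, I-TYPE slot 01b follow-up asked by chem-type-09
2026-08-26T18:30:21Z: «your `LincombPin` may want a `perm` field (identity by default) so `IsLincombOf`
covers aligned parents»), zero compute. Sibling of `Rows/LinearCombination.lean` (nothing there is
edited). Two small definitions (`Model.relabel`, the record `AlignedLincombPin` with its predicates, the
identification `Model.IsAlignedLincombOf`) and theorems; nothing is asserted about any file, no claim
node, no instance, no notation.

WHY. The cell's `dE-direct:d` producer (chem-solver-4) combines an irrep-ALIGNED copy of one parent:
`K⁺_μ = (1 + μ)·P(F_A) − F_B`, `K⁻_ν = (1 + ν)·F_B − P(F_A)` with `P` an ORBITAL PERMUTATION of `F_A`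
(chem-lead IDIFF-SHAPE-A R-A6; the COMBO record prints `π` beside `(c_A, c_B)` and the parent hashes).
`Rows/DifferencePencilAlignedRows.lean` (chem-type-09) proved that the difference rows of the pinned
pair follow from certificates on such files, phrasing the aligned parent through hypotheses
`hh / heri / hcore` on an auxiliary model `F_A′`. This file names the objects a claim node and a referee
quote: the relabelled model itself (`Model.relabel π F`: tables of `F` read through `π`, same `E_core` —
exactly the `F′` of those hypotheses, which become `rfl`), the pin record with the two printed orbital
maps (`AlignedLincombPin`, identity lists when no alignment was applied), and the table-level
identification `K.IsAlignedLincombOf P π_A π_B F G : K = lincomb coeffA coeffB (F.relabel π_A) (G.relabel π_B)`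
together with "the printed lists ARE the graphs of `π_A`, `π_B`"; then every row consequence is one line
from the existing theorems (`Model.energy_eq_of_perm`, `lowerRow/upperRow_iff_of_perm`,
`diffLowerRow/UpperRow_iff_of_perm_left/right`, `diffLowerRow_of_pencil_of_upperRow`,
`diffUpperRow_of_pencil_of_upperRow`, `diffLowerRow_of_lowerRow_sub`, `energy_lincomb_ge`,
`LowerRow.lincomb`).

WHAT.
* §1 `Model.relabel π F` and its API: `relabel_h/eri/ecore` (rfl), `relabel_refl`, `relabel_lincomb`
  (relabelling commutes with combination), `relabel_isSymmetric_iff`, `relabel_energy`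
  (`E₀(P(F); a, b) = E₀(F; a, b)`), `relabel_lowerRow_iff`, `relabel_upperRow_iff`,
  `relabel_diffLowerRow_iff_left/right`, `relabel_diffUpperRow_iff_left/right`.
* §2 `AlignedLincombPin` (= `LincombPin` + `permA`, `permB` : the 0-based image lists `[π(0), …, π(k−1)]`
  as printed), `AlignedLincombPin.permImages k π` (the list a permutation prints), `IsGraphOf`,
  `IsConsistent` (the `LincombPin` consistency + both lists are permutations of `0 … norb−1`),
  `permImages_refl` (the identity prints `List.range k`), `permImages_perm_range`.
* §3 `Model.IsAlignedLincombOf K P π_A π_B F G` and its transport: `.isLincombOf` (it IS an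
  `IsLincombOf` of the relabelled parents), `.hamiltonian`, `.isSymmetric`, `.ecore`, `.lowerRow` (row transport), `.energy_ge` and
  `.lowerRow_of_lowerRows` (non-negative coefficients: `α·E₀(F) + β·E₀(G) ≤ E₀(K)`, free lower rows — alignment
  costs nothing because `E₀` is order-blind), `isAlignedLincombOf_one_one_iff` (identity maps: the plain
  `IsLincombOf` plus the two identity lists).
* §4 THE PENCIL ROWS OF THE PINNED PAIR from an aligned combination file: `.diffLowerRow_of_upperRow`
  (`K = c·P_A(F) − P_B(G)`, `c ≥ 1`, `ℓ ≤ E₀(K)`, `E₀(F) ≤ u` ⊢ `DiffLowerRow F a b G a b (ℓ − (c−1)·u)`),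
  `.diffUpperRow_of_upperRow` (the file with the parents' roles exchanged bounds `ΔE` from above),
  `.diffLowerRow_of_weyl` / `.diffUpperRow_of_weyl` (`c = 1`: no absolute row), the certificate-level
  forms `.diffLowerRow_of_certificates` / `.diffUpperRow_of_certificates` (hypotheses = exactly what the
  claim nodes state: `LowerCertificate K a b ℓ`, `UpperCertificate F a b u`), and the two-sided
  `diffBracket_of_isAlignedLincombOf`.
References (docstrings): the in-house conventions IDIFF-SHAPE-A R-A2/R-A3/R-A6 and FORMAT-pin1 (kind
`lincomb`); FCIDUMP header fields per Knowles–Handy. [cite: KnowlesHandy1989, §2 (FCIDUMP format)]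
-/

noncomputable section

namespace Summit.Ventures.CertifiedQuantumChemistry

open Matrix

/-! ## §1 The relabelled model -/

namespace Model

variable {k : ℕ}

/-- **The orbital-RELABELLED model `P_π(F)`**: the tables of `F` read through the permutation `π` of the
spatial orbitals (`h′_{pq} = h_{π p, π q}`, `(pq|rs)′ = (π p π q|π r π s)`), same core constant — the file an
aligning tool writes before combining (IDIFF-SHAPE-A R-A6), and exactly the auxiliary model `F′` of the
hypotheses `hh / heri / hcore` of `Rows/OrbitalRelabelling.lean` / `Rows/DifferencePencilAlignedRows.lean`
(for `F.relabel π` those hypotheses hold by `rfl`). [cite: KnowlesHandy1989, §2 (FCIDUMP format)] -/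
def relabel (π : Equiv.Perm (Fin k)) (F : Model k) : Model k where
  h p q := F.h (π p) (π q)
  eri p q r s := F.eri (π p) (π q) (π r) (π s)
  ecore := F.ecore

variable (π : Equiv.Perm (Fin k)) (F G : Model k)

/-- One-electron table of the relabelled model (by definition). -/
@[simp] theorem relabel_h (p q : Fin k) : (F.relabel π).h p q = F.h (π p) (π q) := rfl

/-- Two-electron table of the relabelled model (by definition). -/
@[simp] theorem relabel_eri (p q r s : Fin k) :
    (F.relabel π).eri p q r s = F.eri (π p) (π q) (π r) (π s) := rfl

/-- Core constant of the relabelled model: unchanged (by definition). -/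
@[simp] theorem relabel_ecore : (F.relabel π).ecore = F.ecore := rfl

/-- The identity relabelling is the file itself. -/
@[simp] theorem relabel_refl : F.relabel (Equiv.refl (Fin k)) = F := rfl

/-- Relabelling commutes with combination: `P_π(α·F + β·G) = α·P_π(F) + β·P_π(G)` (entrywise). -/
theorem relabel_lincomb (α β : ℚ) : (lincomb α β F G).relabel π = lincomb α β (F.relabel π) (G.relabel π) :=
  rfl

/-- The integral symmetries are order-independent (`Model.isSymmetric_iff_of_perm`). -/
theorem relabel_isSymmetric_iff : (F.relabel π).IsSymmetric ↔ F.IsSymmetric :=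
  Model.isSymmetric_iff_of_perm π (F := F) (F' := F.relabel π) (fun _ _ => rfl) (fun _ _ _ _ => rfl)

/-- **`E₀(H_{P_π(F)}; a, b) = E₀(H_F; a, b)`** for every sector (`Model.energy_eq_of_perm`): the certified
quantity does not see the orbital order. -/
theorem relabel_energy (a b : ℕ) : (F.relabel π).energy a b = F.energy a b :=
  Model.energy_eq_of_perm π (F := F) (F' := F.relabel π) (fun _ _ => rfl) (fun _ _ _ _ => rfl) rfl a b

variable {π F G}

/-- Lower rows of the relabelled file and of the file are equivalent. -/
theorem relabel_lowerRow_iff {a b : ℕ} {lo : ℚ} : LowerRow (F.relabel π) a b lo ↔ LowerRow F a b lo :=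
  lowerRow_iff_of_perm π (F := F) (F' := F.relabel π) (fun _ _ => rfl) (fun _ _ _ _ => rfl) rfl

/-- Upper rows of the relabelled file and of the file are equivalent. -/
theorem relabel_upperRow_iff {a b : ℕ} {hi : ℚ} : UpperRow (F.relabel π) a b hi ↔ UpperRow F a b hi :=
  upperRow_iff_of_perm π (F := F) (F' := F.relabel π) (fun _ _ => rfl) (fun _ _ _ _ => rfl) rfl

/-- Relabelling the FIRST file of a pair does not change its difference lower rows. -/
theorem relabel_diffLowerRow_iff_left {k' : ℕ} {G : Model k'} {a b a' b' : ℕ} {lo : ℚ} :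
    DiffLowerRow (F.relabel π) a b G a' b' lo ↔ DiffLowerRow F a b G a' b' lo :=
  diffLowerRow_iff_of_perm_left π (FA := F) (FA' := F.relabel π) (fun _ _ => rfl) (fun _ _ _ _ => rfl) rfl

/-- Relabelling the SECOND file of a pair does not change the difference lower rows. -/
theorem relabel_diffLowerRow_iff_right {k' : ℕ} {F : Model k'} {G : Model k} {a b a' b' : ℕ} {lo : ℚ} :
    DiffLowerRow F a b (G.relabel π) a' b' lo ↔ DiffLowerRow F a b G a' b' lo :=
  diffLowerRow_iff_of_perm_right π (FB := G) (FB' := G.relabel π) (fun _ _ => rfl) (fun _ _ _ _ => rfl)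
    rfl

/-- Relabelling the FIRST file of a pair does not change its difference upper rows. -/
theorem relabel_diffUpperRow_iff_left {k' : ℕ} {G : Model k'} {a b a' b' : ℕ} {hi : ℚ} :
    DiffUpperRow (F.relabel π) a b G a' b' hi ↔ DiffUpperRow F a b G a' b' hi :=
  diffUpperRow_iff_of_perm_left π (FA := F) (FA' := F.relabel π) (fun _ _ => rfl) (fun _ _ _ _ => rfl) rfl

/-- Relabelling the SECOND file of a pair does not change the difference upper rows. -/
theorem relabel_diffUpperRow_iff_right {k' : ℕ} {F : Model k'} {G : Model k} {a b a' b' : ℕ} {hi : ℚ} :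
    DiffUpperRow F a b (G.relabel π) a' b' hi ↔ DiffUpperRow F a b G a' b' hi :=
  diffUpperRow_iff_of_perm_right π (FB := G) (FB' := G.relabel π) (fun _ _ => rfl) (fun _ _ _ _ => rfl)
    rfl

end Model

/-! ## §2 The pin of a combination of ALIGNED parents -/

/-- **MODEL-PIN of a COMBINATION file with ORBITAL-ALIGNED parents** (kind `lincomb`, IDIFF-SHAPE-A R-A6):
the `LincombPin` record (the file's own pin, the two parents' pins, the exact coefficients) extended by
the two ORBITAL MAPS the combining tool printed — `permA = [π_A(0), …, π_A(k−1)]` applied to parent A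
before combining, `permB` likewise (0-based images; the IDENTITY list `[0, …, k−1]` when that parent was
not reordered: chem-solver-4's `K⁺` files align parent A only, `K⁻` files parent B only). A record; it
asserts nothing; the orbital count `k` is the pins' `norb` (FCIDUMP `NORB`).
[cite: KnowlesHandy1989, §2 (FCIDUMP format)] -/
structure AlignedLincombPin extends LincombPin where
  /-- orbital map applied to parent A, as the printed list of 0-based images (identity if none) -/
  permA : List ℕ
  /-- orbital map applied to parent B, as the printed list of 0-based images (identity if none) -/
  permB : List ℕ

namespace AlignedLincombPin

/-- The list a permutation `π` of `Fin k` prints: `[π(0), π(1), …, π(k−1)]` as natural numbers.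
[cite: KnowlesHandy1989, §2 (FCIDUMP format)] -/
def permImages (k : ℕ) (π : Equiv.Perm (Fin k)) : List ℕ :=
  (List.finRange k).map fun i => ((π i : Fin k) : ℕ)

/-- The identity permutation prints `[0, 1, …, k−1]`. [cite: KnowlesHandy1989, §2 (FCIDUMP format)] -/
theorem permImages_refl (k : ℕ) : permImages k (Equiv.refl (Fin k)) = List.range k := by
  simp only [permImages, Equiv.refl_apply]
  exact List.map_coe_finRange_eq_range

/-- The printed image list of any permutation is a rearrangement of `[0, 1, …, k−1]` (the decidable
sanity check a referee runs on the record). [cite: KnowlesHandy1989, §2 (FCIDUMP format)] -/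
theorem permImages_perm_range (k : ℕ) (π : Equiv.Perm (Fin k)) :
    (permImages k π).Perm (List.range k) := by
  have h := (Equiv.Perm.map_finRange_perm π).map (fun i : Fin k => (i : ℕ))
  rw [List.map_map] at h
  rw [← List.map_coe_finRange_eq_range]
  exact h

/-- **The printed lists ARE the graphs of `(π_A, π_B)`** — the link between the record (lists of
naturals) and the Lean permutations the theorems use. [cite: KnowlesHandy1989, §2 (FCIDUMP format)] -/
def IsGraphOf (P : AlignedLincombPin) {k : ℕ} (πA πB : Equiv.Perm (Fin k)) : Prop :=
  P.permA = permImages k πA ∧ P.permB = permImages k πB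

/-- Lean-checkable CONSISTENCY of an aligned `lincomb` pin: the underlying `LincombPin` is consistent
(`LincombPin.IsConsistent`: well-formed pins, equal `norb`, `E_core` combined term by term — an orbital
relabelling does not change `E_core`) and both printed orbital maps are rearrangements of
`[0, …, norb−1]` (decidable on the literal record). [cite: KnowlesHandy1989, §2 (FCIDUMP format)] -/
def IsConsistent (P : AlignedLincombPin) : Prop :=
  P.toLincombPin.IsConsistent ∧ P.permA.Perm (List.range P.pin.norb) ∧
    P.permB.Perm (List.range P.pin.norb)

/-- A record whose lists are graphs of permutations of `Fin norb` passes the rearrangement check.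
[cite: KnowlesHandy1989, §2 (FCIDUMP format)] -/
theorem IsGraphOf.perm_range {P : AlignedLincombPin} {πA πB : Equiv.Perm (Fin P.pin.norb)}
    (h : P.IsGraphOf πA πB) :
    P.permA.Perm (List.range P.pin.norb) ∧ P.permB.Perm (List.range P.pin.norb) := by
  obtain ⟨hA, hB⟩ := h
  rw [hA, hB]
  exact ⟨permImages_perm_range _ _, permImages_perm_range _ _⟩

end AlignedLincombPin

/-! ## §3 "This literal file IS the combination of the ALIGNED parents the pin names" -/

namespace Model

variable {k : ℕ}

/-- **`K = coeffA·P_{π_A}(F) + coeffB·P_{π_B}(G)` and the pin prints `(π_A, π_B)`**: the table-level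
identification of a literal combination file with aligned parents (closed by `Model.ext'` +
`decide`/`norm_num` on small literal tables, or carried as a claim node quoting the three `model_sha256`
and the two printed lists at large `k`, exactly like `Model.IsLincombOf`).
[cite: KnowlesHandy1989, §2 (FCIDUMP format)] -/
def IsAlignedLincombOf (K : Model k) (P : AlignedLincombPin) (πA πB : Equiv.Perm (Fin k))
    (F G : Model k) : Prop :=
  P.IsGraphOf πA πB ∧ K = lincomb P.coeffA P.coeffB (F.relabel πA) (G.relabel πB)

variable {K F G : Model k} {P : AlignedLincombPin} {πA πB : Equiv.Perm (Fin k)}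

/-- An aligned identification IS a plain `IsLincombOf` — of the RELABELLED parents. -/
theorem IsAlignedLincombOf.isLincombOf (h : K.IsAlignedLincombOf P πA πB F G) :
    K.IsLincombOf P.toLincombPin (F.relabel πA) (G.relabel πB) :=
  h.2

/-- With identity maps the aligned identification is the plain one plus the two identity lists. -/
theorem isAlignedLincombOf_one_one_iff :
    K.IsAlignedLincombOf P 1 1 F G ↔
      (P.permA = List.range k ∧ P.permB = List.range k) ∧ K.IsLincombOf P.toLincombPin F G := by
  unfold IsAlignedLincombOf AlignedLincombPin.IsGraphOf IsLincombOf
  rw [Equiv.Perm.one_def, AlignedLincombPin.permImages_refl, relabel_refl, relabel_refl]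

/-- The combined Hamiltonian: `H_K = coeffA·H_{P_A(F)} + coeffB·H_{P_B(G)}`. -/
theorem IsAlignedLincombOf.hamiltonian (h : K.IsAlignedLincombOf P πA πB F G) :
    K.hamiltonian = ((P.coeffA : ℝ) : ℂ) • (F.relabel πA).hamiltonian +
      ((P.coeffB : ℝ) : ℂ) • (G.relabel πB).hamiltonian :=
  h.isLincombOf.hamiltonian

/-- A combination of aligned symmetric parents is symmetric (so `lowerRow_of_certificate` applies to
the literal `K`-file). -/
theorem IsAlignedLincombOf.isSymmetric (h : K.IsAlignedLincombOf P πA πB F G) (hF : F.IsSymmetric)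
    (hG : G.IsSymmetric) : K.IsSymmetric :=
  h.isLincombOf.isSymmetric ((relabel_isSymmetric_iff πA F).2 hF) ((relabel_isSymmetric_iff πB G).2 hG)

/-- The core constant of the combination is the combination of the parents' core constants — the
ℚ-identity a referee checks on the three pins (R-A2); relabelling does not enter. -/
theorem IsAlignedLincombOf.ecore (h : K.IsAlignedLincombOf P πA πB F G) :
    K.ecore = P.coeffA * F.ecore + P.coeffB * G.ecore := by
  rw [h.isLincombOf.ecore, relabel_ecore, relabel_ecore]

/-- **`coeffA·E₀(F; a,b) + coeffB·E₀(G; a,b) ≤ E₀(K; a,b)`** for non-negative coefficients and symmetric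
parents (`energy_lincomb_ge` on the relabelled parents + `relabel_energy`). -/
theorem IsAlignedLincombOf.energy_ge (h : K.IsAlignedLincombOf P πA πB F G) (hα : 0 ≤ P.coeffA)
    (hβ : 0 ≤ P.coeffB) (hF : F.IsSymmetric) (hG : G.IsSymmetric) {a b : ℕ} (ha : a ≤ k) (hb : b ≤ k) :
    (P.coeffA : ℝ) * F.energy a b + (P.coeffB : ℝ) * G.energy a b ≤ K.energy a b := by
  rw [h.2, ← relabel_energy πA F, ← relabel_energy πB G]
  exact energy_lincomb_ge ((relabel_isSymmetric_iff πA F).2 hF) ((relabel_isSymmetric_iff πB G).2 hG)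
    ha hb hα hβ

/-- Transport of a lower row along the identification (the hypothesis shape of the pencil soundness
theorems): a certified lower row of the literal `K`-file is a lower row of
`lincomb coeffA coeffB (F.relabel π_A) (G.relabel π_B)`. -/
theorem IsAlignedLincombOf.lowerRow (h : K.IsAlignedLincombOf P πA πB F G) {a b : ℕ} {lo : ℚ}
    (hK : LowerRow K a b lo) : LowerRow (lincomb P.coeffA P.coeffB (F.relabel πA) (G.relabel πB)) a b lo :=
  h.isLincombOf.lowerRow hK

/-- **Free lower row of a non-negative combination of aligned parents**: certified lower rows of `F` and
`G` give the lower row `coeffA·lo_F + coeffB·lo_G` of the literal `K`-file (`LowerRow.lincomb` on the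
relabelled parents, whose rows are those of the parents). -/
theorem IsAlignedLincombOf.lowerRow_of_lowerRows (h : K.IsAlignedLincombOf P πA πB F G)
    (hα : 0 ≤ P.coeffA) (hβ : 0 ≤ P.coeffB) (hF : F.IsSymmetric) (hG : G.IsSymmetric) {a b : ℕ}
    {loF loG : ℚ} (hLF : LowerRow F a b loF) (hLG : LowerRow G a b loG) :
    LowerRow K a b (P.coeffA * loF + P.coeffB * loG) := by
  rw [h.2]
  exact LowerRow.lincomb ((relabel_isSymmetric_iff πA F).2 hF) ((relabel_isSymmetric_iff πB G).2 hG)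
    hα hβ (relabel_lowerRow_iff.2 hLF) (relabel_lowerRow_iff.2 hLG)

/-! ## §4 The pencil rows of the PINNED pair from a certificate on an aligned combination file -/

/-- **`dE-direct:d` LOWER row of the pinned pair from an ALIGNED pencil file.** If the literal file `K`
is `c·P_A(F) − P_B(G)` (pin kind `lincomb`, `IsPencil`: `coeffA = c ≥ 1`, `coeffB = −1`), `F`, `G` are
symmetric, `ℓ ≤ E₀(K; a, b)` is a certified lower row and `E₀(F; a, b) ≤ u` a certified upper row, then
`ℓ − (c − 1)·u ≤ E₀(F; a, b) − E₀(G; a, b)` — the row of the PINNED, un-relabelled pair. -/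
theorem IsAlignedLincombOf.diffLowerRow_of_upperRow (h : K.IsAlignedLincombOf P πA πB F G)
    (hp : P.IsPencil) (hF : F.IsSymmetric) (hG : G.IsSymmetric) {a b : ℕ} {ℓ u : ℚ}
    (hK : LowerRow K a b ℓ) (hU : UpperRow F a b u) :
    DiffLowerRow F a b G a b (ℓ - (P.coeffA - 1) * u) := by
  have hK' : LowerRow (lincomb P.coeffA (-1) (F.relabel πA) (G.relabel πB)) a b ℓ := by
    rw [← hp.2, ← h.2]; exact hK
  have hd := diffLowerRow_of_pencil_of_upperRow ((relabel_isSymmetric_iff πA F).2 hF)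
    ((relabel_isSymmetric_iff πB G).2 hG) hp.1 hK' (relabel_upperRow_iff.2 hU)
  exact relabel_diffLowerRow_iff_right.1 (relabel_diffLowerRow_iff_left.1 hd)

/-- **`dE-direct:d` UPPER row of the pinned pair from an ALIGNED pencil file with the roles exchanged.**
If `K = c·P_A(G) − P_B(F)` (`c ≥ 1`), `ℓ ≤ E₀(K; a, b)` and `E₀(G; a, b) ≤ u`, then
`E₀(F; a, b) − E₀(G; a, b) ≤ (c − 1)·u − ℓ`. -/
theorem IsAlignedLincombOf.diffUpperRow_of_upperRow (h : K.IsAlignedLincombOf P πA πB G F)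
    (hp : P.IsPencil) (hF : F.IsSymmetric) (hG : G.IsSymmetric) {a b : ℕ} {ℓ u : ℚ}
    (hK : LowerRow K a b ℓ) (hU : UpperRow G a b u) :
    DiffUpperRow F a b G a b ((P.coeffA - 1) * u - ℓ) := by
  have hK' : LowerRow (lincomb P.coeffA (-1) (G.relabel πA) (F.relabel πB)) a b ℓ := by
    rw [← hp.2, ← h.2]; exact hK
  have hd := diffUpperRow_of_pencil_of_upperRow ((relabel_isSymmetric_iff πB F).2 hF)
    ((relabel_isSymmetric_iff πA G).2 hG) hp.1 hK' (relabel_upperRow_iff.2 hU)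
  exact relabel_diffUpperRow_iff_right.1 (relabel_diffUpperRow_iff_left.1 hd)

/-- **Weyl lower row from an aligned DIFFERENCE file (`c = 1`): no absolute row needed.** If
`K = P_A(F) − P_B(G)` and `ℓ ≤ E₀(K; a, b)` then `ℓ ≤ E₀(F; a, b) − E₀(G; a, b)`. -/
theorem IsAlignedLincombOf.diffLowerRow_of_weyl (h : K.IsAlignedLincombOf P πA πB F G)
    (hA : P.coeffA = 1) (hB : P.coeffB = -1) (hF : F.IsSymmetric) (hG : G.IsSymmetric) {a b : ℕ}
    {ℓ : ℚ} (hK : LowerRow K a b ℓ) : DiffLowerRow F a b G a b ℓ := by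
  have hK' : LowerRow (lincomb 1 (-1) (F.relabel πA) (G.relabel πB)) a b ℓ := by
    rw [← hB, ← hA, ← h.2]; exact hK
  have hd := diffLowerRow_of_lowerRow_sub ((relabel_isSymmetric_iff πA F).2 hF)
    ((relabel_isSymmetric_iff πB G).2 hG) hK'
  exact relabel_diffLowerRow_iff_right.1 (relabel_diffLowerRow_iff_left.1 hd)

/-- **Weyl upper row from the reversed aligned DIFFERENCE file (`c = 1`).** If `K = P_A(G) − P_B(F)` and
`ℓ ≤ E₀(K; a, b)` then `E₀(F; a, b) − E₀(G; a, b) ≤ −ℓ`. -/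
theorem IsAlignedLincombOf.diffUpperRow_of_weyl (h : K.IsAlignedLincombOf P πA πB G F)
    (hA : P.coeffA = 1) (hB : P.coeffB = -1) (hF : F.IsSymmetric) (hG : G.IsSymmetric) {a b : ℕ}
    {ℓ : ℚ} (hK : LowerRow K a b ℓ) : DiffUpperRow F a b G a b (-ℓ) := by
  have hK' : LowerRow (lincomb 1 (-1) (G.relabel πA) (F.relabel πB)) a b ℓ := by
    rw [← hB, ← hA, ← h.2]; exact hK
  have hd := diffUpperRow_of_lowerRow_sub ((relabel_isSymmetric_iff πB F).2 hF)
    ((relabel_isSymmetric_iff πA G).2 hG) hK'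
  exact relabel_diffUpperRow_iff_right.1 (relabel_diffUpperRow_iff_left.1 hd)

/-- **The LOWER row straight from what the claim nodes state**: a FORMAT-qcl1 lower certificate of the
literal aligned pencil file `K` (`LowerCertificate K a b ℓ`, `Rows/SectorRows.lean`) and an explicit-vector
upper certificate of the parent `F` (`UpperCertificate F a b u`), `a, b ≤ k`, give the difference lower
row `ℓ − (c − 1)·u` of the pinned pair. -/
theorem IsAlignedLincombOf.diffLowerRow_of_certificates (h : K.IsAlignedLincombOf P πA πB F G)
    (hp : P.IsPencil) (hF : F.IsSymmetric) (hG : G.IsSymmetric) {a b : ℕ} (ha : a ≤ k) (hb : b ≤ k)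
    {ℓ u : ℚ} (hK : LowerCertificate K a b ℓ) (hU : UpperCertificate F a b u) :
    DiffLowerRow F a b G a b (ℓ - (P.coeffA - 1) * u) :=
  h.diffLowerRow_of_upperRow hp hF hG (lowerRow_of_certificate (h.isSymmetric hF hG) ha hb hK)
    (upperRow_of_certificate hF hU)

/-- **The UPPER row straight from what the claim nodes state** (roles exchanged: `K = c·P_A(G) − P_B(F)`,
lower certificate of `K`, upper certificate of `G`). -/
theorem IsAlignedLincombOf.diffUpperRow_of_certificates (h : K.IsAlignedLincombOf P πA πB G F)
    (hp : P.IsPencil) (hF : F.IsSymmetric) (hG : G.IsSymmetric) {a b : ℕ} (ha : a ≤ k) (hb : b ≤ k)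
    {ℓ u : ℚ} (hK : LowerCertificate K a b ℓ) (hU : UpperCertificate G a b u) :
    DiffUpperRow F a b G a b ((P.coeffA - 1) * u - ℓ) :=
  h.diffUpperRow_of_upperRow hp hF hG (lowerRow_of_certificate (h.isSymmetric hG hF) ha hb hK)
    (upperRow_of_certificate hG hU)

end Model

/-- **THE TWO-SIDED `dE-direct:d` BRACKET of the pinned pair `(F, G)` from two ALIGNED pencil files**:
`K_A = c_A·P(F) − P′(G)` certified from below by `ℓ_A` with `E₀(F) ≤ u_F`, and `K_B = c_B·Q(G) − Q′(F)`
certified from below by `ℓ_B` with `E₀(G) ≤ u_G`, give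
`ΔE = E₀(F; a,b) − E₀(G; a,b) ∈ [ℓ_A − (c_A − 1)·u_F, (c_B − 1)·u_G − ℓ_B]`. -/
theorem diffBracket_of_isAlignedLincombOf {k : ℕ} {KA KB F G : Model k} {PA PB : AlignedLincombPin}
    {πA πB πA' πB' : Equiv.Perm (Fin k)} (hA : KA.IsAlignedLincombOf PA πA πB F G)
    (hB : KB.IsAlignedLincombOf PB πA' πB' G F) (hpA : PA.IsPencil) (hpB : PB.IsPencil)
    (hF : F.IsSymmetric) (hG : G.IsSymmetric) {a b : ℕ} {ℓA uF ℓB uG : ℚ} (hKA : LowerRow KA a b ℓA)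
    (hUF : UpperRow F a b uF) (hKB : LowerRow KB a b ℓB) (hUG : UpperRow G a b uG) :
    DiffBracket F a b G a b (ℓA - (PA.coeffA - 1) * uF) ((PB.coeffA - 1) * uG - ℓB) :=
  ⟨hA.diffLowerRow_of_upperRow hpA hF hG hKA hUF, hB.diffUpperRow_of_upperRow hpB hF hG hKB hUG⟩

end Summit.Ventures.CertifiedQuantumChemistry

end
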